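import Summits.PneNP.PneNP.Theorems.SymmetryBudgetNoHiddenOrderPerPathRefine

/-!
# `refineIn` is self-ranked: a refined colouring is determined by its order

Route `PneNP/SymmetryBudget`, `NoHiddenOrder` (stmt-PneNP-14781); support for the symmetric compilation (R2c) of the certified scheme over the
components-only Corneil–Goldberg process. The replay circuit exposes colourings only through ORDER/KERNEL wires (`ReplayIter.StateReads`), while the
certified scheme compares colourings as functions `V → ℕ` (decoding, certification of candidate children) and records their VALUES in the encodings.
This file closes that gap for the colourings the process actually produces, which are all of the form `refineIn G B c`:

* `ocrStep_eq_card_lt` — one ordered refinement round is SELF-RANKED: the new colour of `u` is the number of vertices of smaller new colour;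
* `refineIn_eq_card_lt` — hence for `v ∈ B`, `refineIn G B c v = #{w ∈ B | refineIn G B c w < refineIn G B c v}`, and it is `0` off `B`
  (`refineIn_eq_zero_of_not_mem`);
* `refineIn_eq_of_lt_iff` — **two refined colourings of the same block with the same strict order on the block are EQUAL as functions**; so
  "same colouring" is decidable from order wires on the block, and colour values are counting gates over them (`refineIn_lt_card`: values `< |B|`).
-/

-- `Summit.PneNP.PneNP.…` duplicates `PneNP` BY DESIGN (single-problem summit, D-0017 layout).
set_option linter.dupNamespace false

namespace Summit.PneNP.PneNP.Theorems

open Finset Literature.Combinatorics.SimpleGraph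

namespace BranchSum

variable {V : Type*} [DecidableEq V] {G : SimpleGraph V} [DecidableRel G.Adj]

/-- **One ordered refinement round is self-ranked**: the new colour of `u` is the number of vertices with a smaller new colour. -/
theorem ocrStep_eq_card_lt {W : Type*} [Fintype W] (H : SimpleGraph W) [DecidableRel H.Adj] (col : W → ℕ) (u : W) :
    ocrStep H col u = (univ.filter fun w => ocrStep H col w < ocrStep H col u).card := by
  show (univ.filter fun w => KeyLT H col w u).card = _
  congr 1
  ext w
  simp only [mem_filter, mem_univ, true_and, ocrStep_lt_iff]

/-- After at least one round, ordered colour refinement is self-ranked. -/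
theorem ocrIter_eq_card_lt {W : Type*} [Fintype W] (H : SimpleGraph W) [DecidableRel H.Adj] (col : W → ℕ) {t : ℕ} (ht : 0 < t) (u : W) :
    ocrIter H col t u = (univ.filter fun w => ocrIter H col t w < ocrIter H col t u).card := by
  obtain ⟨s, rfl⟩ := Nat.exists_eq_add_of_lt ht
  rw [Nat.zero_add, ocrIter_succ]
  exact ocrStep_eq_card_lt H _ u

/-- `refineIn` vanishes off the block. -/
theorem refineIn_eq_zero_of_not_mem {B : Finset V} (c : V → ℕ) {v : V} (hv : v ∉ B) : refineIn G B c v = 0 := by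
  unfold refineIn; rw [dif_neg hv]

/-- **`refineIn` is self-ranked on the block**: for `v ∈ B` its value is the number of vertices of `B` with a smaller value. -/
theorem refineIn_eq_card_lt {B : Finset V} (c : V → ℕ) {v : V} (hv : v ∈ B) :
    refineIn G B c v = (B.filter fun w => refineIn G B c w < refineIn G B c v).card := by
  have hpos : 0 < B.card := card_pos.2 ⟨v, hv⟩
  set f : ↥(B : Set V) → ℕ := ocrIter (G.induce (B : Set V)) (fun x : ↥(B : Set V) => c x) B.card with hf
  -- count over the subtype `↥B` versus over `B`
  have key : (univ.filter fun w : ↥(B : Set V) => f w < f ⟨v, mem_coe.2 hv⟩).map (Function.Embedding.subtype _) =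
      B.filter fun w => refineIn G B c w < refineIn G B c v := by
    ext w
    simp only [mem_map, mem_filter, mem_univ, true_and, Function.Embedding.coe_subtype, Subtype.exists, mem_coe, exists_and_right,
      exists_eq_right]
    constructor
    · rintro ⟨hw, hlt⟩
      refine ⟨hw, ?_⟩
      rwa [refineIn_apply c hw, refineIn_apply c hv]
    · rintro ⟨hw, hlt⟩
      refine ⟨hw, ?_⟩
      rwa [refineIn_apply c hw, refineIn_apply c hv] at hlt
  rw [← key, card_map]
  conv_lhs => rw [refineIn_apply c hv]
  exact ocrIter_eq_card_lt _ _ hpos _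

/-- Refined colour values are below the size of the block. -/
theorem refineIn_lt_card {B : Finset V} (c : V → ℕ) {v : V} (hv : v ∈ B) : refineIn G B c v < B.card := by
  rw [refineIn_eq_card_lt c hv]
  exact card_lt_card ((filter_ssubset).2 ⟨v, hv, lt_irrefl _⟩)

/-- **A refined colouring is determined by its strict order on the block**: two refined colourings of the same block whose strict orders agree
on the block are equal as functions (both vanish off the block). -/
theorem refineIn_eq_of_lt_iff {B : Finset V} {a b : V → ℕ}
    (h : ∀ u ∈ B, ∀ w ∈ B, (refineIn G B a u < refineIn G B a w ↔ refineIn G B b u < refineIn G B b w)) :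
    refineIn G B a = refineIn G B b := by
  funext v
  by_cases hv : v ∈ B
  · rw [refineIn_eq_card_lt a hv, refineIn_eq_card_lt b hv]
    congr 1
    ext w
    simp only [mem_filter, and_congr_right_iff]
    exact fun hw => h w hw v hv
  · rw [refineIn_eq_zero_of_not_mem a hv, refineIn_eq_zero_of_not_mem b hv]

/-- The same with order AND kernel hypotheses in the shape of `StateReads` (`<` and `=` wires): agreeing `<` suffices, this is a convenience form. -/
theorem refineIn_eq_of_lt_iff_of_eq_iff {B : Finset V} {a b : V → ℕ}
    (hlt : ∀ u ∈ B, ∀ w ∈ B, (refineIn G B a u < refineIn G B a w ↔ refineIn G B b u < refineIn G B b w))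
    (_heq : ∀ u ∈ B, ∀ w ∈ B, (refineIn G B a u = refineIn G B a w ↔ refineIn G B b u = refineIn G B b w)) :
    refineIn G B a = refineIn G B b :=
  refineIn_eq_of_lt_iff hlt

end BranchSum

end Summit.PneNP.PneNP.Theorems
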